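import Summits.AnomalousDissipation.AnomalousDissipation.Theorems.SawtoothPulseCascadeK2InjectionH

/-!
# K2″ injection phase under the cap `5·e^{σ⋆γ}` for every `γ ≤ 8` (the `J = j₀` phase of the crux `K2GrowthCtgPointH`)
(route `AnomalousDissipation/SawtoothPulseCascade`; helper for the crux K2″ = stmt-AnomalousDissipation-19696 / its SHAPE-Q v2
re-target `K2GrowthCtgPointH := ∃ δ₀ ∈ Ioc 0 2⁻¹⁰⁰, K2PhaseGrowthClassicalH ⟨8, δ₀, 2, 1, 2⟩ 5`, arbiter A25-8/A25-9/A25-11 «job 3»)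

The landed injection-phase lemmas give, for EVERY `ν > 0` and every parameter point (`γ ≥ 0`, `δ₀ > 0`, `d > 0`):
`‖w(t)‖² ≤ e^{γ}‖w₀‖²` on the whole H injection window (`k2_injectionPhase_H`: parallel heat on the H half, energy
method on the V half) and `‖w(t)‖² ≤ ‖w₀‖²` on the V injection window (`k2_injectionPhase_V`).  With the route's old
constant `3` the cap `(3e^{σ⋆γ})²` swallows `e^{γ}` only for `γ ≤ 5.77` (`injectionPhase_of_le_577`); with the constant
`5` of the re-targeted crux it does so for every `γ ≤ 8`:
`e^{γ} = e^{(1−2σ⋆)γ}·(e^{σ⋆γ})² ≤ e^{(1−2σ⋆)·8}·(e^{σ⋆γ})² = e^{3.04288}·(e^{σ⋆γ})² ≤ 21·(e^{σ⋆γ})² ≤ (5e^{σ⋆γ})²`.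

* `exp_one_sub_two_mul_sawSigmaStar_mul_eight_le` — `e^{(1−2σ⋆)·8} ≤ 21`;
* `exp_le_cap5_sq` — `e^{γ} ≤ (5e^{σ⋆γ})²` for `γ ≤ 8`;
* `k2_injectionPhase_cap5` — the `J = j₀` instance of the body of `K2PhaseGrowthClassical(H) P 5` (both half-slot
  types, every `ν > 0`, every `P` with `0 ≤ P.γ ≤ 8`): `‖w(t)‖² ≤ (5e^{σ⋆γ})^{2(j₀+1−j₀)}‖w₀‖²` on
  `[max (tInject j₀ hz) (tStart j₀), tStart (j₀+1)]`.
So in the crux `K2GrowthCtgPointH` only the phases `J > j₀` carry content.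
-/

set_option linter.dupNamespace false

noncomputable section

namespace Summit.AnomalousDissipation.AnomalousDissipation.Theorems.SawtoothPulseCascade.K2Classical

open Set MeasureTheory
open scoped ContDiff
open Literature.Analysis Literature.Analysis.FunctionSpaces Literature.Analysis.FluidPDE
open Literature.Analysis.FluidPDE.SawtoothCascade
open Literature.Analysis.FluidPDE.SawtoothCascade.CascadeParams

/-- `e^{(1 − 2σ⋆)·8} = e^{3.04288} ≤ 21` (`σ⋆ = 0.30982`; `e^{3.04288} = e³·e^{0.04288} ≤ 2.7182818286³ · 1.04382 ≤ 20.97`;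
Mathlib's `Real.exp_one_lt_d9` and `Real.exp_bound'` with three terms). [folklore] -/
theorem exp_one_sub_two_mul_sawSigmaStar_mul_eight_le :
    Real.exp ((1 - 2 * sawSigmaStar) * 8) ≤ 21 := by
  have hx : (1 - 2 * sawSigmaStar) * 8 = 1 + 1 + 1 + 0.04288 := by
    simp only [sawSigmaStar]
    norm_num
  have h1 : Real.exp 1 < 2.7182818286 := Real.exp_one_lt_d9
  have h2 : Real.exp (0.04288 : ℝ) ≤ 1.04382 := by
    have h := Real.exp_bound' (x := (0.04288 : ℝ)) (by norm_num) (by norm_num) (n := 3) (by norm_num)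
    have hs : (∑ m ∈ Finset.range 3, (0.04288 : ℝ) ^ m / m.factorial) +
        (0.04288 : ℝ) ^ 3 * (3 + 1) / (Nat.factorial 3 * 3) ≤ 1.04382 := by
      simp only [Finset.sum_range_succ, Finset.sum_range_zero, Nat.factorial]
      norm_num
    exact h.trans (by exact_mod_cast hs)
  have he0 : 0 < Real.exp 1 := Real.exp_pos 1
  have h111 : Real.exp 1 * Real.exp 1 * Real.exp 1 ≤ 2.7182818286 * 2.7182818286 * 2.7182818286 := by
    have h11 : Real.exp 1 * Real.exp 1 ≤ 2.7182818286 * 2.7182818286 := by nlinarith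
    nlinarith
  rw [hx, Real.exp_add, Real.exp_add, Real.exp_add]
  calc Real.exp 1 * Real.exp 1 * Real.exp 1 * Real.exp 0.04288
      ≤ 2.7182818286 * 2.7182818286 * 2.7182818286 * 1.04382 :=
        mul_le_mul h111 h2 (Real.exp_pos _).le (by norm_num)
    _ ≤ 21 := by norm_num

/-- `e^{γ} ≤ (5e^{σ⋆γ})²` for `γ ≤ 8`: the cap `5·e^{σ⋆γ}` of ONE phase swallows the energy-method factor of ONE
half pulse on the whole design range (`e^{γ} = e^{(1−2σ⋆)γ}(e^{σ⋆γ})² ≤ 21(e^{σ⋆γ})² ≤ 25(e^{σ⋆γ})²`). [folklore] -/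
theorem exp_le_cap5_sq {γ : ℝ} (hγ : γ ≤ 8) :
    Real.exp γ ≤ (5 * Real.exp (sawSigmaStar * γ)) ^ 2 := by
  have hmono : Real.exp ((1 - 2 * sawSigmaStar) * γ) ≤ Real.exp ((1 - 2 * sawSigmaStar) * 8) := by
    refine Real.exp_le_exp.2 (mul_le_mul_of_nonneg_left hγ ?_)
    norm_num [sawSigmaStar]
  have h21 := hmono.trans exp_one_sub_two_mul_sawSigmaStar_mul_eight_le
  have hsplit : Real.exp γ = Real.exp ((1 - 2 * sawSigmaStar) * γ) * Real.exp (sawSigmaStar * γ) ^ 2 := by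
    rw [sq, ← Real.exp_add, ← Real.exp_add]
    ring_nf
  rw [hsplit, mul_pow]
  have hE : 0 ≤ Real.exp (sawSigmaStar * γ) ^ 2 := sq_nonneg _
  calc Real.exp ((1 - 2 * sawSigmaStar) * γ) * Real.exp (sawSigmaStar * γ) ^ 2
      ≤ 21 * Real.exp (sawSigmaStar * γ) ^ 2 := mul_le_mul_of_nonneg_right h21 hE
    _ ≤ 5 ^ 2 * Real.exp (sawSigmaStar * γ) ^ 2 := by nlinarith

/-- `0 ≤ ∫‖v‖²`. -/
private theorem vectorL2Sq_nonneg' (v : UnitAddTorus (Fin 2) → EuclideanSpace ℝ (Fin 2)) :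
    0 ≤ Torus.vectorL2Sq v := by
  unfold Torus.vectorL2Sq
  exact integral_nonneg fun _ => by positivity

/-- **The injection phase under the cap `5·e^{σ⋆γ}`, both half-slot types, every `ν > 0`, `0 ≤ γ ≤ 8`** — the
`J = j₀` instance of the body of `K2PhaseGrowthClassical P 5` / `K2PhaseGrowthClassicalH P 5` (conclusion window
`[max (tInject j₀ hz) (tStart j₀), tStart (j₀+1)]`, exponent `2(j₀+1−j₀)`): `hz = true` by `k2_injectionPhase_H` (factor
`e^{γ}`) and `exp_le_cap5_sq`; `hz = false` by `k2_injectionPhase_V_bound` (factor `1 ≤ 5e^{σ⋆γ}`). -/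
theorem k2_injectionPhase_cap5 (P : CascadeParams) (hγ : 0 ≤ P.γ) (hγ8 : P.γ ≤ 8) (hδ₀ : 0 < P.δ₀)
    (hd : 0 < P.d) {ν : ℝ} (hν : 0 < ν) (j₀ : ℕ) (hz : Bool)
    (w₀ : UnitAddTorus (Fin 2) → EuclideanSpace ℝ (Fin 2))
    (w : ℝ → UnitAddTorus (Fin 2) → EuclideanSpace ℝ (Fin 2)) (q : ℝ → UnitAddTorus (Fin 2) → ℝ)
    (hdat : ShearCombDatum (P.N j₀) hz w₀)
    (hw : Torus.IsSmoothSpaceTimeOn (Icc (CascadeParams.tInject j₀ hz) (tStart (j₀ + 1))) w)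
    (hq : Torus.IsSmoothSpaceTimeOn (Icc (CascadeParams.tInject j₀ hz) (tStart (j₀ + 1))) q)
    (hdiv : ∀ t ∈ Icc (CascadeParams.tInject j₀ hz) (tStart (j₀ + 1)), Torus.IsDivFree (w t))
    (hlin : ∀ t ∈ Icc (CascadeParams.tInject j₀ hz) (tStart (j₀ + 1)), ∀ x,
      Torus.timeDerivWithin (Icc (CascadeParams.tInject j₀ hz) (tStart (j₀ + 1))) w t x +
        Torus.convect (P.field t) (w t) x + Torus.convect (w t) (P.field t) x =
          ν • Torus.laplacian (w t) x - Torus.gradient (q t) x)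
    (h0 : w (CascadeParams.tInject j₀ hz) = w₀) :
    ∀ t ∈ Icc (max (CascadeParams.tInject j₀ hz) (tStart j₀)) (tStart (j₀ + 1)),
      Torus.vectorL2Sq (w t) ≤
        (5 * Real.exp (sawSigmaStar * P.γ)) ^ (2 * (j₀ + 1 - j₀)) * Torus.vectorL2Sq w₀ := by
  cases hz with
  | false =>
    have hC : 1 ≤ 5 * Real.exp (sawSigmaStar * P.γ) := by
      have h0' : (0 : ℝ) ≤ sawSigmaStar * P.γ := mul_nonneg (by norm_num [sawSigmaStar]) hγ
      linarith [Real.one_le_exp h0']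
    exact k2_injectionPhase_V_bound P hδ₀ hd hC hν j₀ w₀ w q hdat hw hq hdiv hlin h0
  | true =>
    intro t ht
    have hexp : 2 * (j₀ + 1 - j₀) = 2 := by rw [Nat.add_sub_cancel_left]
    rw [hexp]
    have ht' : t ∈ Icc (CascadeParams.tInject j₀ true) (tStart (j₀ + 1)) := ⟨(le_max_left _ _).trans ht.1, ht.2⟩
    exact (k2_injectionPhase_H P hγ hδ₀ hd hν j₀ w₀ w q hdat hw hq hdiv hlin h0 t ht').trans
      (mul_le_mul_of_nonneg_right (exp_le_cap5_sq hγ8) (vectorL2Sq_nonneg' w₀))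

/-- **At the design point of the re-targeted crux** (`P = ⟨8, δ₀, 2, 1, 2⟩`, any `δ₀ > 0`, every `ν > 0`): the
`J = j₀` instance of the body of `K2PhaseGrowthClassicalH ⟨8, δ₀, 2, 1, 2⟩ 5` holds — so only the phases `J > j₀` of
`K2GrowthCtgPointH` carry content. -/
theorem k2_injectionPhase_cap5_eight {δ₀ : ℝ} (hδ₀ : 0 < δ₀) {ν : ℝ} (hν : 0 < ν) (j₀ : ℕ) (hz : Bool)
    (w₀ : UnitAddTorus (Fin 2) → EuclideanSpace ℝ (Fin 2))
    (w : ℝ → UnitAddTorus (Fin 2) → EuclideanSpace ℝ (Fin 2)) (q : ℝ → UnitAddTorus (Fin 2) → ℝ)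
    (hdat : ShearCombDatum (((⟨8, δ₀, 2, 1, 2⟩ : CascadeParams)).N j₀) hz w₀)
    (hw : Torus.IsSmoothSpaceTimeOn (Icc (CascadeParams.tInject j₀ hz) (tStart (j₀ + 1))) w)
    (hq : Torus.IsSmoothSpaceTimeOn (Icc (CascadeParams.tInject j₀ hz) (tStart (j₀ + 1))) q)
    (hdiv : ∀ t ∈ Icc (CascadeParams.tInject j₀ hz) (tStart (j₀ + 1)), Torus.IsDivFree (w t))
    (hlin : ∀ t ∈ Icc (CascadeParams.tInject j₀ hz) (tStart (j₀ + 1)), ∀ x,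
      Torus.timeDerivWithin (Icc (CascadeParams.tInject j₀ hz) (tStart (j₀ + 1))) w t x +
        Torus.convect ((⟨8, δ₀, 2, 1, 2⟩ : CascadeParams).field t) (w t) x +
        Torus.convect (w t) ((⟨8, δ₀, 2, 1, 2⟩ : CascadeParams).field t) x =
          ν • Torus.laplacian (w t) x - Torus.gradient (q t) x)
    (h0 : w (CascadeParams.tInject j₀ hz) = w₀) :
    ∀ t ∈ Icc (max (CascadeParams.tInject j₀ hz) (tStart j₀)) (tStart (j₀ + 1)),
      Torus.vectorL2Sq (w t) ≤ (5 * Real.exp (sawSigmaStar * 8)) ^ (2 * (j₀ + 1 - j₀)) * Torus.vectorL2Sq w₀ :=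
  k2_injectionPhase_cap5 ⟨8, δ₀, 2, 1, 2⟩ (by norm_num) le_rfl hδ₀ (by norm_num) hν j₀ hz w₀ w q hdat hw hq hdiv
    hlin h0

end Summit.AnomalousDissipation.AnomalousDissipation.Theorems.SawtoothPulseCascade.K2Classical

end
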